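import Summits.QuantumAdvantage.QuantumAdvantage.Theorems.WbwObfuscatedGluedTreesKowPhPrograms
import Literature.Computability.Complexity.OraclePrefixPost

/-!
# `WbwObfuscatedGluedTrees` (stmt-QuantumAdvantage-2340) — line `knowledge-of-walk-split`, STAGE 7 (the PRF hybrid):
# the walker wrapper of the reduction (registered stub `stub_outer`)

Helper file of the PRF hybrid (stage 7) of the line `knowledge-of-walk-split`.  The reduction `ℬ` of stage 7 is
`(walker wrapper) ∘ (layer C) ∘ (layer B)`; this file builds the WALKER WRAPPER: one polynomial-time oracle machine
`M : OracleAlg Bool` which, on the distinguisher's input `⟨1ⁿ, r⟩` (`r` the walker's coins) and against an oracle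
`O'` answering CODED REQUESTS `codeC (n, req) = ⟨1ⁿ, req⟩` (`KowPhPrograms` §5: `codeC (n, [true]) ↦ name(EXIT)`,
`codeC (n, 0·u) ↦` the request oracle of the instance at `u`),

* runs the walker `𝒜.alg` CLOCKED by its own round budget (`OracleAlg.clockFst 𝒜.fuel []`, default output `[]`),
  forwarding each walker request `u` as the coded request `codeC (n, 0 · cap u)`, where `cap` keeps a request of
  length `≤ 2N + 1` and replaces a longer one by its first bit (invisible to an oracle answering long requests by
  their first bit, the hypothesis; it keeps the queries polynomially SHORT) — `OracleAlg.mapQuery`;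
* asks the private request `codeC (n, [true])` FIRST (`OracleAlg.prefixShift 1`: one blank query, hidden from the
  walker, re-coded by the outer `mapQuery`), and
* outputs the bit "the private answer is a prefix of the walker's output" (`OracleAlg.postOut` reading the first
  answer of the transcript).

§1 two transcript lemmas on `prefixShift`; §2 the run and the queries of the wrapper against an arbitrary oracle
(`run_mapQuery` twice, `run_prefixShift`, `runAux_postOut`, `run_clockFst_boolPair`); §3 the three string maps in
the `CodeFP` algebra (the cap bound `2N + 1`, `N = μ + 2d + 3`, from the schedules `1ⁿ ↦ 1^μ`, `1ⁿ ↦ 1^d` on codes)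
and the polynomial bound on `N`; §4 the registered stub.

[folklore] (oracle machines and the composition of polynomial-time computations: AroraBarak2009 §3.4, §1.3;
the PRF distinguisher built from an adversary: Goldreich2001 Def. 3.6.4).
-/

set_option linter.dupNamespace false

noncomputable section

namespace Summit.QuantumAdvantage.QuantumAdvantage.Theorems.WbwObfuscatedGluedTrees.KnowledgeOfWalk.PrfHybrid

open Literature.Computability.Complexity Literature.Computability.QuantumComplexity
open Literature.Computability.QuantumComplexity.GluedTrees
open Literature.Computability.Cryptography Literature.Computability.Cryptography.ObfuscatedGluedTrees
open Summit.QuantumAdvantage.QuantumAdvantage.Theorems.WbwObfuscatedGluedTrees.KnowledgeOfWalk.BlackBox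
open Summit.QuantumAdvantage.QuantumAdvantage.Theorems.WbwObfuscatedGluedTrees.KnowledgeOfWalk.RealIdeal
open _root_.Computability
open Literature.Computability.Complexity.CodeFP (unE pairE strE listE bitE natE rawE fst snd const strTake
  strLength natOfUn unSucc unAdd unMulConst unLeNat rawOfList rawHeadD consBit)

/-! ## §1 Transcripts of `prefixShift` -/

section PrefixShift

variable {β : Type}

/-- Once `k` answers are in, the queries of `M.prefixShift k` are those of `M` on the later answers (the transcript
twin of `OracleAlg.runAux_prefixShift_of_le`). [folklore] -/
private theorem queriesAux_prefixShift_of_le (M : OracleAlg β) (k : ℕ) (O : Oracle) (x : List Bool) :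
    ∀ (n : ℕ) (as : List (List Bool)), k ≤ as.length →
      (M.prefixShift k).queriesAux O x n as = M.queriesAux O x n (as.drop k)
  | 0, _, _ => rfl
  | n + 1, as, h => by
    simp only [OracleAlg.queriesAux, OracleAlg.prefixShift_step, if_neg (Nat.not_lt.2 h)]
    cases M.step x (as.drop k) with
    | inr b => rfl
    | inl q =>
      dsimp only
      rw [queriesAux_prefixShift_of_le M k O x n (as ++ [O q]) (by simp; omega), List.drop_append_of_le_length h]

/-- The queries of `M.prefixShift 1` from the start: the blank query, then the queries of `M`. [folklore] -/
private theorem queriesAux_prefixShift_one (M : OracleAlg β) (O : Oracle) (x : List Bool) (n : ℕ) :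
    (M.prefixShift 1).queriesAux O x (n + 1) [] = [] :: M.queriesAux O x n [] := by
  have h1 : (M.prefixShift 1).queriesAux O x (n + 1) [] = [] :: (M.prefixShift 1).queriesAux O x n [O []] := by
    simp only [OracleAlg.queriesAux, OracleAlg.prefixShift_step, List.length_nil, zero_lt_one, if_true,
      List.nil_append]
  rw [h1, queriesAux_prefixShift_of_le M 1 O x n [O []] (by simp)]
  rfl

end PrefixShift

/-! ## §2 The wrapper against an arbitrary oracle: run and queries -/

section Sem

/-- **Semantics of the walker wrapper.**  For string maps `d₁` (forward a walker request, capped at `b`, as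
`0 · cap u`), `d₂` (re-code a request `q` as `codeC (n, q)`, the blank one as the private request
`codeC (n, [true])`) and `h` (the bit "first answer is a prefix of the output") with the stated values on the step
inputs over `⟨1ⁿ, r⟩`, and an oracle `O'` answering over-long walker requests by their first bit: with fuel
`k + 1`, `k` above the walker's clock, the wrapper outputs the bit "`O' (codeC (n, [true]))` is a prefix of the
clocked walker's output against `u ↦ O' (codeC (n, 0·u))`", and every query it asks is a coded request of length
`≤ 2n + b + 4`. [cite: AroraBarak2009, §3.4] -/
private theorem outer_sem (A : OracleAlg (List Bool)) (qA : Polynomial ℕ) (d₁ d₂ h : List Bool → List Bool)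
    (b n : ℕ) (r : List Bool) (O' : Oracle)
    (hd₁v : ∀ (as : List (List Bool)) (u : List Bool),
      d₁ (boolPair (boolPair (gameInput n) r) (boolPair ((encodingList Bool).listBool.encode as) u)) =
        false :: (if u.length ≤ b then u else u.take 1))
    (hd₂v : ∀ (as : List (List Bool)) (q : List Bool),
      d₂ (boolPair (boolPair (gameInput n) r) (boolPair ((encodingList Bool).listBool.encode as) q)) =
        codeC (n, if q = [] then [true] else q))
    (hhv : ∀ (as : List (List Bool)) (w : List Bool),
      h (boolPair (boolPair (gameInput n) r) (boolPair ((encodingList Bool).listBool.encode as) w)) =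
        [decide (as.headD [] <+: w)])
    (hcap : ∀ u : List Bool, b < u.length → O' (codeC (n, false :: u)) = O' (codeC (n, [false, u.headD false])))
    {k : ℕ} (hk : qA.eval (gameInput n).length < k) :
    ((((A.clockFst qA []).mapQuery d₁).prefixShift 1).postOut h |>.mapQuery d₂).run O' (k + 1)
          (boolPair (gameInput n) r) =
        some (decide (O' (codeC (n, [true])) <+:
          ((A.run (fun u => O' (codeC (n, false :: u))) (qA.eval (gameInput n).length)
            (boolPair (gameInput n) r)).getD []))) ∧
      ∀ y ∈ ((((A.clockFst qA []).mapQuery d₁).prefixShift 1).postOut h |>.mapQuery d₂).queries O' (k + 1)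
          (boolPair (gameInput n) r),
        y.length ≤ 2 * n + b + 4 ∧ ∃ req : List Bool, y = codeC (n, req) := by
  -- the single oracles of the two `mapQuery` layers
  have hag₂ : OracleAlg.MapAgree ((((A.clockFst qA []).mapQuery d₁).prefixShift 1).postOut h) d₂ O'
      (fun q => O' (codeC (n, if q = [] then [true] else q))) (boolPair (gameInput n) r) := by
    intro i q _ _
    rw [hd₂v]
  have hag₁ : OracleAlg.MapAgree (A.clockFst qA []) d₁ (fun q => O' (codeC (n, if q = [] then [true] else q)))
      (fun u => O' (codeC (n, false :: u))) (boolPair (gameInput n) r) := by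
    intro i q _ _
    simp only [hd₁v, reduceCtorEq, if_false]
    by_cases hc : q.length ≤ b
    · rw [if_pos hc]
    · have hlt : b < q.length := Nat.lt_of_not_le hc
      rw [if_neg hc, hcap q hlt]
      cases q with
      | nil => exact absurd hlt (Nat.not_lt_zero _)
      | cons c q => rfl
  -- the runs, layer by layer
  have hr₀ := OracleAlg.run_clockFst_boolPair A qA [] (fun u => O' (codeC (n, false :: u))) (gameInput n) r hk
  have hr₁ : ((A.clockFst qA []).mapQuery d₁).run (fun q => O' (codeC (n, if q = [] then [true] else q))) k
      (boolPair (gameInput n) r) =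
        some ((A.run (fun u => O' (codeC (n, false :: u))) (qA.eval (gameInput n).length)
          (boolPair (gameInput n) r)).getD []) := by
    rw [OracleAlg.run_mapQuery _ d₁ _ _ _ hag₁ k, hr₀]
  have hr₂ : (((A.clockFst qA []).mapQuery d₁).prefixShift 1).runAux
      (fun q => O' (codeC (n, if q = [] then [true] else q))) (boolPair (gameInput n) r) (k + 1) [] =
        some ((A.run (fun u => O' (codeC (n, false :: u))) (qA.eval (gameInput n).length)
          (boolPair (gameInput n) r)).getD []) :=
    (OracleAlg.run_prefixShift _ 1 _ _ k).trans hr₁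
  have hq₂ := queriesAux_prefixShift_one ((A.clockFst qA []).mapQuery d₁)
    (fun q => O' (codeC (n, if q = [] then [true] else q))) (boolPair (gameInput n) r) k
  have hr₃ := OracleAlg.runAux_postOut _ h _ _ (k + 1) [] _ hr₂
  rw [hq₂] at hr₃
  simp only [List.nil_append, List.map_cons, if_true, hhv, List.headD_cons] at hr₃
  refine ⟨?_, fun y hy => ?_⟩
  · rw [OracleAlg.run_mapQuery _ d₂ _ _ _ hag₂ (k + 1)]
    exact hr₃.1
  · obtain ⟨i, q, -, -, hq, rfl⟩ := OracleAlg.queries_mapQuery _ d₂ _ _ _ hag₂ (k + 1) hy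
    rw [hd₂v]
    refine ⟨?_, _, rfl⟩
    change q ∈ OracleAlg.queriesAux _ _ _ (k + 1) [] at hq
    rw [hr₃.2] at hq
    have hn : (gameInput n).length = n := CodeFP.length_unE n
    rcases List.mem_cons.1 hq with rfl | hq
    · simp only [codeC, length_boolPair, hn, if_true, List.length_singleton]
      omega
    · obtain ⟨i', q₀, -, -, -, rfl⟩ := OracleAlg.queries_mapQuery _ d₁ _ _ _ hag₁ k hq
      rw [hd₁v]
      simp only [codeC, length_boolPair, hn, reduceCtorEq, if_false, List.length_cons]
      have hc : (if q₀.length ≤ b then q₀ else q₀.take 1).length ≤ b + 1 := by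
        split_ifs with hc
        · exact hc.trans (Nat.le_succ b)
        · rw [List.length_take]; omega
      omega

end Sem

/-! ## §3 The three string maps and the polynomial bound on the name length -/

section Codes

variable {α : Type} {eα : α → List Bool}

/-- **The capped forwarding map** `0 · cap u` of a computed string `u` at a computed unary bound `b`
(`cap u = u` if `|u| ≤ b`, else its first bit). [cite: AroraBarak2009, §1.3] -/
private theorem codeFP_capCons {fb : α → ℕ} {fu : α → List Bool} (hb : CodeFP eα unE fb) (hu : CodeFP eα strE fu) :
    CodeFP eα strE (fun a => false :: (if (fu a).length ≤ fb a then fu a else (fu a).take 1)) :=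
  (consBit.comp ((const eα false).pair ((unLeNat.comp ((strLength.comp hu).pair (natOfUn.comp hb))).ite hu
    (strTake.comp ((const eα 1).pair hu))))).congr fun a => by
      by_cases hc : (fu a).length ≤ fb a <;> simp [hc]

/-- **The request re-coding map** `codeC (n, q)` (the blank query `q = ε` becoming the private request `[true]`)
of a computed unary `n` and a computed string `q`. [cite: AroraBarak2009, §1.3] -/
private theorem codeFP_codeReq {fn : α → ℕ} {fq : α → List Bool} (hn : CodeFP eα unE fn) (hq : CodeFP eα strE fq) :
    CodeFP eα strE (fun a => codeC (fn a, if fq a = [] then [true] else fq a)) :=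
  (hn.pair ((((CodeFP.eq (eα := strE) fun _ _ h => h).comp (hq.pair (const eα ([] : List Bool)))).ite
    (const eα [true]) hq))).recodeOut fun a => by
      by_cases hc : fq a = [] <;> simp [hc, codeC]

/-- **The prefix test** `[a <+: w]` of two computed strings (`w ↾ |a| = a`). [cite: AroraBarak2009, §1.3] -/
private theorem codeFP_prefixTest {fa fw : α → List Bool} (ha : CodeFP eα strE fa) (hw : CodeFP eα strE fw) :
    CodeFP eα bitE (fun a => decide (fa a <+: fw a)) :=
  ((CodeFP.eq (eα := strE) fun _ _ h => h).comp ((strTake.comp ((strLength.comp ha).pair hw)).pair ha)).congr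
    fun a => decide_eq_decide.2 (by rw [List.prefix_iff_eq_take]; exact eq_comm)

/-- **The cap bound `2N + 1`, `N = nameLen μ d = μ + 2d + 3`, in unary** from the two schedules on codes. [folklore] -/
private theorem codeFP_bnd (Λ : Params) (hμ : CodeFP unE unE Λ.prfParam) (hd : CodeFP unE unE Λ.depth) :
    CodeFP unE unE (fun n => nameLen (Λ.prfParam n) (Λ.depth n) + nameLen (Λ.prfParam n) (Λ.depth n) + 1) := by
  have hN : CodeFP unE unE (fun n => nameLen (Λ.prfParam n) (Λ.depth n)) :=
    (unAdd.comp (hμ.pair (unSucc.comp (unSucc.comp (unSucc.comp ((unMulConst 2).comp hd)))))).congr fun n => by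
      simp [nameLen, labelLen]
  exact (unSucc.comp (unAdd.comp (hN.pair hN))).congr fun _ => rfl

/-- **The three string maps of the wrapper exist in `FP`** with the required values on the step inputs
`⟨⟨1ⁿ, r⟩, ⟨code of the answers, u⟩⟩` (read as the code `pairE (pairE unE strE) (pairE (listE strE) strE)`).
[cite: AroraBarak2009, §1.3] -/
private theorem exists_maps (Λ : Params) (hμ : CodeFP unE unE Λ.prfParam) (hd : CodeFP unE unE Λ.depth) :
    ∃ d₁ ∈ FP, ∃ d₂ ∈ FP, ∃ h ∈ FP, ∀ (n : ℕ) (r : List Bool) (as : List (List Bool)) (u : List Bool),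
      d₁ (boolPair (boolPair (gameInput n) r) (boolPair ((encodingList Bool).listBool.encode as) u)) =
          false :: (if u.length ≤ nameLen (Λ.prfParam n) (Λ.depth n) + nameLen (Λ.prfParam n) (Λ.depth n) + 1
            then u else u.take 1) ∧
        d₂ (boolPair (boolPair (gameInput n) r) (boolPair ((encodingList Bool).listBool.encode as) u)) =
          codeC (n, if u = [] then [true] else u) ∧
        h (boolPair (boolPair (gameInput n) r) (boolPair ((encodingList Bool).listBool.encode as) u)) =
          [decide (as.headD [] <+: u)] := by
  have key : ∀ (n : ℕ) (r : List Bool) (as : List (List Bool)) (u : List Bool),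
      boolPair (boolPair (gameInput n) r) (boolPair ((encodingList Bool).listBool.encode as) u) =
        pairE (pairE unE strE) (pairE (listE strE) strE) ((n, r), (as, u)) := fun n r as u => by
    rw [CodeFP.listE_eq]; rfl
  have pn : CodeFP (pairE (pairE unE strE) (pairE (listE strE) strE)) unE (fun t => t.1.1) := (fst _ _).fst'
  have pas : CodeFP (pairE (pairE unE strE) (pairE (listE strE) strE)) (listE strE) (fun t => t.2.1) :=
    (snd _ _).fst'
  have pu : CodeFP (pairE (pairE unE strE) (pairE (listE strE) strE)) strE (fun t => t.2.2) := (snd _ _).snd'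
  obtain ⟨d₁, hd₁, h₁⟩ := codeFP_capCons ((codeFP_bnd Λ hμ hd).comp pn) pu
  obtain ⟨d₂, hd₂, h₂⟩ := codeFP_codeReq pn pu
  obtain ⟨h, hh, h₃⟩ := codeFP_prefixTest ((rawHeadD strE (d := ([] : List Bool)) rfl).comp
    ((rawOfList strE).comp pas)) pu
  refine ⟨d₁, hd₁, d₂, hd₂, h, hh, fun n r as u => ?_⟩
  rw [key]
  exact ⟨h₁ _, h₂ _, h₃ _⟩

/-- A schedule computed on unary codes is polynomially bounded (the output of an `FP` function is polynomially
long). [cite: AroraBarak2009, §1.3] -/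
private theorem exists_poly_of_codeFP_unE {g : ℕ → ℕ} (hg : CodeFP unE unE g) : ∃ p : Polynomial ℕ, ∀ n, g n ≤ p.eval n := by
  obtain ⟨f, hf, hfg⟩ := hg
  obtain ⟨p, hp⟩ := exists_poly_length_le_of_mem_FP hf
  refine ⟨p, fun n => ?_⟩
  have h := hp (unE n)
  rwa [hfg, CodeFP.length_unE, CodeFP.length_unE] at h

end Codes

/-! ## §4 The registered stub -/

/-- **Stub (the walker wrapper of the reduction)**: given the two schedules on codes and a PPT walker, one
polynomial-time Boolean oracle machine `M` and a polynomial `qM` such that, against every oracle `O'` answering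
over-long walker requests by their first bit, `M` on `⟨1ⁿ, r⟩` within `qM(|⟨1ⁿ, r⟩|)` rounds outputs the bit
"`O' (codeC (n, [true]))` is a prefix of the output of the walker run with its own budget against
`u ↦ O' (codeC (n, 0·u))`", asking only coded requests `codeC (n, req)` of length `≤ qM(|⟨1ⁿ, r⟩|)`.
[cite: Goldreich2001, Def. 3.6.4] -/
theorem stub_outer :
    ∀ (Λ : Params) (𝒜 : OracleAdversary (List Bool)),
      CodeFP unE unE Λ.prfParam → CodeFP unE unE Λ.depth → 𝒜.IsPPT (encodingList Bool) →
      ∃ M : OracleAlg Bool, M.IsPolyTime encodingBoolBool ∧ ∃ qM : Polynomial ℕ,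
        ∀ (O' : Oracle) (n : ℕ) (r : List Bool),
          (∀ u : List Bool,
              nameLen (Λ.prfParam n) (Λ.depth n) + nameLen (Λ.prfParam n) (Λ.depth n) + 1 < u.length →
                O' (codeC (n, false :: u)) = O' (codeC (n, [false, u.headD false]))) →
          M.run O' (qM.eval (boolPair (gameInput n) r).length) (boolPair (gameInput n) r) =
              some (decide (O' (codeC (n, [true])) <+:
                ((𝒜.alg.run (fun u => O' (codeC (n, false :: u))) (𝒜.fuel.eval (gameInput n).length)
                  (boolPair (gameInput n) r)).getD []))) ∧
            ∀ y ∈ M.queries O' (qM.eval (boolPair (gameInput n) r).length) (boolPair (gameInput n) r),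
              y.length ≤ qM.eval (boolPair (gameInput n) r).length ∧ ∃ req : List Bool, y = codeC (n, req) := by
  intro Λ 𝒜 hμ hd h𝒜
  obtain ⟨d₁, hd₁, d₂, hd₂, h, hh, hv⟩ := exists_maps Λ hμ hd
  obtain ⟨pμ, hpμ⟩ := exists_poly_of_codeFP_unE hμ
  obtain ⟨pd, hpd⟩ := exists_poly_of_codeFP_unE hd
  have h0 : 𝒜.alg.IsPolyTime (encodingList Bool) := h𝒜
  refine ⟨((((𝒜.alg.clockFst 𝒜.fuel []).mapQuery d₁).prefixShift 1).postOut h).mapQuery d₂,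
    OracleAlg.isPolyTime_mapQuery _ (OracleAlg.isPolyTime_postOut (OracleAlg.isPolyTime_prefixShift _
      (OracleAlg.isPolyTime_mapQuery _ (OracleAlg.isPolyTime_clockFst _ h0 _ _) hd₁) 1) hh) hd₂,
    𝒜.fuel + Polynomial.X + 2 * (pμ + 2 * pd) + 10, fun O' n r hcap => ?_⟩
  have hn : (gameInput n).length = n := CodeFP.length_unE n
  have hL : (boolPair (gameInput n) r).length = 2 * n + 2 + r.length := by rw [length_boolPair, hn]
  have hmono : ∀ p : Polynomial ℕ, p.eval n ≤ p.eval (boolPair (gameInput n) r).length := fun p =>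
    TM2Iter.eval_mono p (by omega)
  have hN : nameLen (Λ.prfParam n) (Λ.depth n) ≤
      pμ.eval (boolPair (gameInput n) r).length + 2 * pd.eval (boolPair (gameInput n) r).length + 3 := by
    have h1 := (hpμ n).trans (hmono pμ)
    have h2 := (hpd n).trans (hmono pd)
    simp only [nameLen, labelLen]
    omega
  have hfuel := hmono 𝒜.fuel
  have hq : (𝒜.fuel + Polynomial.X + 2 * (pμ + 2 * pd) + 10 : Polynomial ℕ).eval (boolPair (gameInput n) r).length =
      (𝒜.fuel.eval (boolPair (gameInput n) r).length + (boolPair (gameInput n) r).length +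
        2 * (pμ.eval (boolPair (gameInput n) r).length + 2 * pd.eval (boolPair (gameInput n) r).length) + 9) + 1 := by
    simp only [Polynomial.eval_add, Polynomial.eval_mul, Polynomial.eval_X, Polynomial.eval_ofNat]
    omega
  rw [hq]
  have hsem := outer_sem 𝒜.alg 𝒜.fuel d₁ d₂ h
    (nameLen (Λ.prfParam n) (Λ.depth n) + nameLen (Λ.prfParam n) (Λ.depth n) + 1) n r O'
    (fun as u => (hv n r as u).1) (fun as q => (hv n r as q).2.1) (fun as w => (hv n r as w).2.2) hcap
    (k := 𝒜.fuel.eval (boolPair (gameInput n) r).length + (boolPair (gameInput n) r).length +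
      2 * (pμ.eval (boolPair (gameInput n) r).length + 2 * pd.eval (boolPair (gameInput n) r).length) + 9)
    (by rw [hn]; omega)
  refine ⟨hsem.1, fun y hy => ?_⟩
  obtain ⟨hlen, hreq⟩ := hsem.2 y hy
  exact ⟨by omega, hreq⟩

end Summit.QuantumAdvantage.QuantumAdvantage.Theorems.WbwObfuscatedGluedTrees.KnowledgeOfWalk.PrfHybrid

end
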